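import Literature.Analysis.FluidPDE.GaussianVortexBiotSavartBound
import Literature.Analysis.FluidPDE.PlanarBiotSavartDivFree
import HarnessLib

/-!
# `∫ ⟪K_{2D} ∗ (ρ_λu₁), ∇(ρ_λu₂)⟫ = 0` on the form domain `H¹(μ_λ)`

Analysis/FluidPDE file (all results proved, no definitions, no named facts), part of the theory
behind the named fact `GallayMaekawa2016_thm41` (Gallay–Maekawa 2016, Thm. 4.1). For
`U₁ = (u₁, ∇u₁)`, `U₂ = (u₂, ∇u₂)` in the form domain `H¹(μ_λ)` (`GaussianVortexFormDomain`), the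
vorticity `w₂ = ρ_λ u₂` has weak gradient `ρ_λ(∇u₂ − u₂ b_λ)`, `b_λ = ∇q_λ = ((1+λ)x₀/2, (1−λ)x₁/2)`,
and the velocity `v₁ = K_{2D} ∗ (ρ_λu₁)` is bounded (`GaussianVortexBiotSavartBound`) and weakly
divergence-free (`PlanarBiotSavartDivFree`). We prove

  `∫ ⟪v₁(x), ρ_λ(x)(∇u₂(x) − u₂(x) b_λ(x))⟫ dx = 0`      (`integral_inner_biotSavart_weakGrad_eq_zero`),

i.e. `∫ v₁·∇w₂ = 0`: the transport nonlinearity `(v·∇)ω` of (4.2) has zero mass, so that it is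
admissible data for the inversion of `L_λ` on mean-zero vorticities
(`GaussianVortexLinearLamSolver`). Steps: second moment of `μ_λ` (`integrable_norm_sq_mul_expNegQuadLam`);
`∇(ρ_λψ) = ρ_λ(∇ψ − ψ b_λ)` for test functions; the identity on graphs from
`integral_inner_biotSavart2D_gradient_eq_zero`; and passage to the closure in `U₂`, the identity
being `⟪V₁, ∇u₂⟫_{L²(μ_λ;ℝ²)} = ⟪⟪v₁, b_λ⟫, u₂⟫_{L²(μ_λ)}` with both sides continuous in `U₂`.

## References

* Th. Gallay, Y. Maekawa, *Existence and stability of viscous vortices*, arXiv:1610.08384, §4.1,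
  (4.2). [GallayMaekawa2016]
-/

open MeasureTheory Filter Set WithLp Metric
open scoped Real RealInnerProductSpace Topology InnerProductSpace ContDiff ENNReal

noncomputable section

namespace Literature.Analysis.FluidPDE

open Literature.Analysis.UnboundedOperators

variable {lam : ℝ}

/-! ### The drift vector `b_λ = ∇q_λ` and `∇(ρ_λψ) = ρ_λ(∇ψ − ψ b_λ)` -/

/-- `∇q_λ(x) = b_λ(x) = ((1+λ)x₀/2, (1−λ)x₁/2)`, `q_λ(x) = (1+λ)x₀²/4 + (1−λ)x₁²/4`. [folklore] -/
theorem gradient_quadraticLam (x : EuclideanSpace ℝ (Fin 2)) :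
    gradient (fun y : EuclideanSpace ℝ (Fin 2) => (1 + lam) / 4 * y 0 ^ 2 + (1 - lam) / 4 * y 1 ^ 2) x =
      toLp 2 ![(1 + lam) / 2 * x 0, (1 - lam) / 2 * x 1] := by
  ext i
  rw [gradient_apply_eq_fderiv_fin_two, (hasFDerivAt_quadraticLam lam x).fderiv]
  fin_cases i <;> simp <;> ring

/-- `‖b_λ(x)‖ ≤ |x|` for `0 ≤ λ < 1`. [folklore] -/
theorem norm_driftLam_le (hlam : lam ∈ Set.Ico (0 : ℝ) 1) (x : EuclideanSpace ℝ (Fin 2)) :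
    ‖(toLp 2 ![(1 + lam) / 2 * x 0, (1 - lam) / 2 * x 1] : EuclideanSpace ℝ (Fin 2))‖ ≤ ‖x‖ := by
  rw [← gradient_quadraticLam, norm_gradient_eq_norm_fderiv_fin_two]
  exact norm_fderiv_quadraticLam_le hlam x

/-- **`∇(ρ_λψ) = ρ_λ(∇ψ − ψ b_λ)`** for differentiable `ψ`. [folklore] -/
theorem gradient_weight_mul {ψ : EuclideanSpace ℝ (Fin 2) → ℝ} (hψ : Differentiable ℝ ψ)
    (x : EuclideanSpace ℝ (Fin 2)) :
    gradient (fun y : EuclideanSpace ℝ (Fin 2) =>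
        Real.exp (-((1 + lam) / 4 * y 0 ^ 2 + (1 - lam) / 4 * y 1 ^ 2)) * ψ y) x =
      Real.exp (-((1 + lam) / 4 * x 0 ^ 2 + (1 - lam) / 4 * x 1 ^ 2)) •
        (gradient ψ x - ψ x • (toLp 2 ![(1 + lam) / 2 * x 0, (1 - lam) / 2 * x 1] :
          EuclideanSpace ℝ (Fin 2))) := by
  have hρd := hasFDerivAt_exp_neg_quadraticLam lam x
  have hψd := (hψ x).hasFDerivAt
  ext i
  rw [gradient_apply_eq_fderiv_fin_two, (hρd.fun_mul hψd).fderiv]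
  have hcomp : (gradient ψ x - ψ x • (toLp 2 ![(1 + lam) / 2 * x 0, (1 - lam) / 2 * x 1] :
      EuclideanSpace ℝ (Fin 2))) i =
      gradient ψ x i - ψ x * (![(1 + lam) / 2 * x 0, (1 - lam) / 2 * x 1] i) := by
    simp
  rw [PiLp.smul_apply, smul_eq_mul, hcomp, gradient_apply_eq_fderiv_fin_two]
  fin_cases i <;> simp <;> ring

/-! ### The second moment of `μ_λ` -/

section Moment

variable (hlam : lam ∈ Set.Ico (0 : ℝ) 1)
include hlam

/-- **`∫ |x|² ρ_λ < ∞`**, with `∫ |x|²ρ_λ ≤ (8/(1−λ)) ∫ρ_λ` (the moment bound on `H¹(μ_λ)` for the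
constant `(1, 0) ∈ H¹(μ_λ)`). [folklore] -/
theorem integrable_norm_sq_mul_expNegQuadLam :
    Integrable fun x : EuclideanSpace ℝ (Fin 2) =>
      ‖x‖ ^ 2 * Real.exp (-((1 + lam) / 4 * x 0 ^ 2 + (1 - lam) / 4 * x 1 ^ 2)) := by
  obtain ⟨hint, -⟩ := integral_norm_sq_mul_sq_le_of_mem_gaussLamFormDomain hlam
    (one_mem_gaussLamFormDomain hlam)
  have hae := (ae_gaussLamMeasure_iff lam).1 (gaussLamOne_ae_eq hlam)
  refine hint.congr ?_
  filter_upwards [hae] with x hx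
  have hfst : (toLp 2 (gaussLamOne hlam, (0 : Lp (EuclideanSpace ℝ (Fin 2)) 2 (gaussLamMeasure lam))) :
      WithLp 2 (Lp ℝ 2 (gaussLamMeasure lam) × Lp (EuclideanSpace ℝ (Fin 2)) 2 (gaussLamMeasure lam))).fst =
      gaussLamOne hlam := rfl
  rw [hfst, hx, one_pow, mul_one]

/-- `x ↦ |x|` lies in `L²(μ_λ)`. [folklore] -/
theorem memLp_two_norm_gaussLamMeasure :
    MemLp (fun x : EuclideanSpace ℝ (Fin 2) => ‖x‖) 2 (gaussLamMeasure lam) := by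
  rw [memLp_two_iff_integrable_sq continuous_norm.aestronglyMeasurable, integrable_gaussLamMeasure_iff]
  exact integrable_norm_sq_mul_expNegQuadLam hlam

end Moment

/-! ### The velocity `v₁ = K_{2D} ∗ (ρ_λ u₁)` and the identity on graphs -/

section Velocity

variable (hlam : lam ∈ Set.Ico (0 : ℝ) 1)
include hlam

omit hlam in
/-- `w = ρ_λ u` is measurable for `u ∈ L²(μ_λ)` (chosen representative). [folklore] -/
theorem measurable_weight_mul_Lp (u : Lp ℝ 2 (gaussLamMeasure lam)) :
    Measurable fun y : EuclideanSpace ℝ (Fin 2) =>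
      Real.exp (-((1 + lam) / 4 * y 0 ^ 2 + (1 - lam) / 4 * y 1 ^ 2)) *
        (u : EuclideanSpace ℝ (Fin 2) → ℝ) y :=
  (continuous_expNegQuadLam lam).measurable.mul (Lp.stronglyMeasurable u).measurable

/-- **`∫ ⟪v₁, ∇(ρ_λψ)⟫ = 0` on graphs**: for `U₁ ∈ H¹(μ_λ)`, `v₁ = K_{2D} ∗ (ρ_λu₁)`, and a test
function `ψ`, `∫ ⟪v₁(x), ρ_λ(x)(∇ψ(x) − ψ(x) b_λ(x))⟫ dx = 0`
(`integral_inner_biotSavart2D_gradient_eq_zero` with `h = ρ_λψ ∈ C¹_c`, the Biot–Savart integrals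
of `ρ_λu₁` converging absolutely with a uniform bound). [folklore] -/
theorem integral_inner_biotSavart_weight_smul_graph_eq_zero
    {U₁ : WithLp 2 (Lp ℝ 2 (gaussLamMeasure lam) × Lp (EuclideanSpace ℝ (Fin 2)) 2 (gaussLamMeasure lam))}
    (hU₁ : U₁ ∈ gaussLamFormDomain lam) (ψ : planarTestFunctions) :
    ∫ x : EuclideanSpace ℝ (Fin 2),
      ⟪biotSavart2D (fun y : EuclideanSpace ℝ (Fin 2) =>
          Real.exp (-((1 + lam) / 4 * y 0 ^ 2 + (1 - lam) / 4 * y 1 ^ 2)) *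
            (U₁.fst : EuclideanSpace ℝ (Fin 2) → ℝ) y) x,
        Real.exp (-((1 + lam) / 4 * x 0 ^ 2 + (1 - lam) / 4 * x 1 ^ 2)) •
          (gradient (ψ : EuclideanSpace ℝ (Fin 2) → ℝ) x - (ψ : EuclideanSpace ℝ (Fin 2) → ℝ) x •
            (toLp 2 ![(1 + lam) / 2 * x 0, (1 - lam) / 2 * x 1] : EuclideanSpace ℝ (Fin 2)))⟫ = 0 := by
  obtain ⟨hwi, -⟩ := integrable_weight_mul_Lp hlam U₁.fst
  have hK := integrable_weight_mul_smul_biotSavartKernel2D hlam hU₁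
  have hM := integral_norm_weight_mul_smul_biotSavartKernel2D_le hlam hU₁
  have hψc : ContDiff ℝ ∞ (ψ : EuclideanSpace ℝ (Fin 2) → ℝ) := planarTestFunctions.contDiff ψ
  have hh : ContDiff ℝ 1 fun y : EuclideanSpace ℝ (Fin 2) =>
      Real.exp (-((1 + lam) / 4 * y 0 ^ 2 + (1 - lam) / 4 * y 1 ^ 2)) * (ψ : EuclideanSpace ℝ (Fin 2) → ℝ) y :=
    (contDiff_exp_neg_quadraticLam lam (n := 1)).mul (hψc.of_le (by simp))
  have hhc : HasCompactSupport fun y : EuclideanSpace ℝ (Fin 2) =>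
      Real.exp (-((1 + lam) / 4 * y 0 ^ 2 + (1 - lam) / 4 * y 1 ^ 2)) * (ψ : EuclideanSpace ℝ (Fin 2) → ℝ) y :=
    (planarTestFunctions.hasCompactSupport ψ).mul_left
  have key := integral_inner_biotSavart2D_gradient_eq_zero hwi hK hM hh hhc
  rw [← key]
  refine integral_congr_ae (Eventually.of_forall fun x => ?_)
  dsimp only
  rw [gradient_weight_mul (hψc.differentiable (by simp))]

end Velocity

/-! ### Passage to the closure in the second argument -/

section Closure

variable (hlam : lam ∈ Set.Ico (0 : ℝ) 1)
include hlam

/-- **`∫ ⟪v₁, ρ_λ(∇u₂ − u₂ b_λ)⟫ = 0` for all `U₁, U₂ ∈ H¹(μ_λ)`** — the transport term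
`v₁·∇w₂`, `w₂ = ρ_λu₂`, `v₁ = K_{2D} ∗ (ρ_λ u₁)`, has zero mass. In `L²(μ_λ)` form: with `V₁ = v₁` as
an element of `L²(μ_λ; ℝ²)` and `Φ₁ = ⟪v₁, b_λ⟫ ∈ L²(μ_λ)` (`v₁` bounded, `|b_λ| ≤ |x| ∈ L²(μ_λ)`),
`⟪V₁, ∇u₂⟫ = ⟪Φ₁, u₂⟫`; both sides are continuous in `U₂`, and on graphs this is the previous
identity. [folklore] -/
theorem inner_biotSavart_snd_eq_inner_drift_fst
    {U₁ : WithLp 2 (Lp ℝ 2 (gaussLamMeasure lam) × Lp (EuclideanSpace ℝ (Fin 2)) 2 (gaussLamMeasure lam))}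
    (hU₁ : U₁ ∈ gaussLamFormDomain lam) :
    ∃ (hV : MemLp (biotSavart2D (fun y : EuclideanSpace ℝ (Fin 2) =>
          Real.exp (-((1 + lam) / 4 * y 0 ^ 2 + (1 - lam) / 4 * y 1 ^ 2)) *
            (U₁.fst : EuclideanSpace ℝ (Fin 2) → ℝ) y)) 2 (gaussLamMeasure lam))
      (hΦ : MemLp (fun x : EuclideanSpace ℝ (Fin 2) =>
          ⟪biotSavart2D (fun y : EuclideanSpace ℝ (Fin 2) =>
            Real.exp (-((1 + lam) / 4 * y 0 ^ 2 + (1 - lam) / 4 * y 1 ^ 2)) *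
              (U₁.fst : EuclideanSpace ℝ (Fin 2) → ℝ) y) x,
            (toLp 2 ![(1 + lam) / 2 * x 0, (1 - lam) / 2 * x 1] : EuclideanSpace ℝ (Fin 2))⟫)
          2 (gaussLamMeasure lam)),
      ∀ {U₂ : WithLp 2 (Lp ℝ 2 (gaussLamMeasure lam) × Lp (EuclideanSpace ℝ (Fin 2)) 2 (gaussLamMeasure lam))},
        U₂ ∈ gaussLamFormDomain lam → ⟪hV.toLp _, U₂.snd⟫ = ⟪hΦ.toLp _, U₂.fst⟫ := by
  have hq : 0 < 1 - lam := by linarith [hlam.2]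
  set ρ : EuclideanSpace ℝ (Fin 2) → ℝ := fun y =>
    Real.exp (-((1 + lam) / 4 * y 0 ^ 2 + (1 - lam) / 4 * y 1 ^ 2)) with hρ_def
  have hρpos : ∀ y, 0 < ρ y := fun y => Real.exp_pos _
  have hρc : Continuous ρ := continuous_expNegQuadLam lam
  set w₁ : EuclideanSpace ℝ (Fin 2) → ℝ := fun y => ρ y * (U₁.fst : EuclideanSpace ℝ (Fin 2) → ℝ) y with hw₁
  set v₁ : EuclideanSpace ℝ (Fin 2) → EuclideanSpace ℝ (Fin 2) := biotSavart2D w₁ with hv₁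
  set b : EuclideanSpace ℝ (Fin 2) → EuclideanSpace ℝ (Fin 2) := fun x =>
    toLp 2 ![(1 + lam) / 2 * x 0, (1 - lam) / 2 * x 1] with hb
  -- `v₁` is measurable and bounded
  have hv₁m : StronglyMeasurable v₁ := stronglyMeasurable_biotSavart2D (measurable_weight_mul_Lp U₁.fst)
  set M₁ : ℝ := (2 * Real.pi)⁻¹ * ((2 * Real.sqrt (2 * (1 + 16 / (1 - lam) ^ 2 + 8 / (1 - lam))) +
      ∫ z, indicator (ball (0 : EuclideanSpace ℝ (Fin 2)) 1) (fun z => ‖z‖⁻¹) z) / 2 +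
    Real.sqrt (∫ y : EuclideanSpace ℝ (Fin 2), ρ y)) * ‖U₁‖ with hM₁
  have hv₁b : ∀ x, ‖v₁ x‖ ≤ M₁ := fun x => norm_biotSavart2D_weight_mul_le hlam hU₁ x
  have hbc : Continuous b := by
    refine (PiLp.continuous_toLp 2 _).comp (continuous_pi fun i => ?_)
    fin_cases i
    · exact continuous_const.mul (PiLp.continuous_apply 2 _ 0)
    · exact continuous_const.mul (PiLp.continuous_apply 2 _ 1)
  have hbn : ∀ x, ‖b x‖ ≤ ‖x‖ := norm_driftLam_le hlam
  -- the `L²(μ_λ)` representatives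
  have hV : MemLp v₁ 2 (gaussLamMeasure lam) :=
    memLp_two_gaussLamMeasure_of_bound hlam hv₁m.aestronglyMeasurable hv₁b
  have hΦ : MemLp (fun x => ⟪v₁ x, b x⟫) 2 (gaussLamMeasure lam) := by
    refine MemLp.of_le ((memLp_two_norm_gaussLamMeasure hlam).const_mul M₁)
      ((hv₁m.inner hbc.stronglyMeasurable).aestronglyMeasurable) (Eventually.of_forall fun x => ?_)
    rw [Real.norm_eq_abs, Real.norm_eq_abs]
    calc |⟪v₁ x, b x⟫| ≤ ‖v₁ x‖ * ‖b x‖ := abs_real_inner_le_norm _ _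
      _ ≤ M₁ * ‖x‖ := mul_le_mul (hv₁b x) (hbn x) (norm_nonneg _) ((norm_nonneg _).trans (hv₁b x))
      _ ≤ |M₁ * ‖x‖| := le_abs_self _
  refine ⟨hV, hΦ, fun {U₂} hU₂ => ?_⟩
  refine gaussLamFormDomain_induction lam (P := fun U₂ => ⟪hV.toLp _, U₂.snd⟫ = ⟪hΦ.toLp _, U₂.fst⟫)
    ?_ ?_ hU₂
  · exact isClosed_eq (continuous_const.inner (WithLp.continuous_snd _ _ _))
      (continuous_const.inner (WithLp.continuous_fst _ _ _))
  · intro ψ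
    have hψc : ContDiff ℝ ∞ (ψ : EuclideanSpace ℝ (Fin 2) → ℝ) := planarTestFunctions.contDiff ψ
    have hψs : HasCompactSupport (ψ : EuclideanSpace ℝ (Fin 2) → ℝ) := planarTestFunctions.hasCompactSupport ψ
    have hgc : Continuous (gradient (ψ : EuclideanSpace ℝ (Fin 2) → ℝ)) :=
      planarTestFunctions.continuous_gradient ψ
    have hgs : HasCompactSupport (gradient (ψ : EuclideanSpace ℝ (Fin 2) → ℝ)) :=
      planarTestFunctions.hasCompactSupport_gradient ψ
    -- the two sides as Lebesgue integrals
    have hL : ⟪hV.toLp _, (gaussLamGraph lam ψ).snd⟫ =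
        ∫ x, ⟪v₁ x, gradient (ψ : EuclideanSpace ℝ (Fin 2) → ℝ) x⟫ * ρ x := by
      rw [L2.inner_def, ← integral_gaussLamMeasure]
      refine integral_congr_ae ?_
      filter_upwards [MemLp.coeFn_toLp hV,
        MemLp.coeFn_toLp (memLp_gradient_planarTestFunction lam ψ)] with x hx hx'
      rw [gaussLamGraph_snd, hx, hx']
    have hR : ⟪hΦ.toLp _, (gaussLamGraph lam ψ).fst⟫ =
        ∫ x, ⟪v₁ x, b x⟫ * (ψ : EuclideanSpace ℝ (Fin 2) → ℝ) x * ρ x := by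
      rw [L2.inner_def, ← integral_gaussLamMeasure]
      refine integral_congr_ae ?_
      filter_upwards [MemLp.coeFn_toLp hΦ,
        MemLp.coeFn_toLp (memLp_planarTestFunction lam ψ)] with x hx hx'
      rw [gaussLamGraph_fst, RCLike.inner_apply, conj_trivial, hx, hx']
      ring
    rw [hL, hR]
    -- integrability of both integrands (bounded `v₁` against compactly supported data)
    have hA : Integrable fun x => ⟪v₁ x, gradient (ψ : EuclideanSpace ℝ (Fin 2) → ℝ) x⟫ * ρ x := by
      refine Integrable.mono' (((hgc.norm.mul hρc).integrable_of_hasCompactSupport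
        hgs.norm.mul_right).const_mul M₁)
        ((hv₁m.inner hgc.stronglyMeasurable).aestronglyMeasurable.mul hρc.aestronglyMeasurable)
        (Eventually.of_forall fun x => ?_)
      rw [norm_mul, Real.norm_of_nonneg (hρpos x).le, Real.norm_eq_abs]
      calc |⟪v₁ x, gradient (ψ : EuclideanSpace ℝ (Fin 2) → ℝ) x⟫| * ρ x
          ≤ ‖v₁ x‖ * ‖gradient (ψ : EuclideanSpace ℝ (Fin 2) → ℝ) x‖ * ρ x :=
            mul_le_mul_of_nonneg_right (abs_real_inner_le_norm _ _) (hρpos x).le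
        _ ≤ M₁ * ‖gradient (ψ : EuclideanSpace ℝ (Fin 2) → ℝ) x‖ * ρ x := by
            gcongr
            exact hv₁b x
        _ = M₁ * (‖gradient (ψ : EuclideanSpace ℝ (Fin 2) → ℝ) x‖ * ρ x) := by ring
    have hB : Integrable fun x => ⟪v₁ x, b x⟫ * (ψ : EuclideanSpace ℝ (Fin 2) → ℝ) x * ρ x := by
      have hmaj : Integrable fun x : EuclideanSpace ℝ (Fin 2) =>
          M₁ * (‖x‖ * |(ψ : EuclideanSpace ℝ (Fin 2) → ℝ) x| * ρ x) :=
        (((continuous_norm.mul hψc.continuous.abs).mul hρc).integrable_of_hasCompactSupport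
          (hψs.mono (by
            intro x hx
            simp only [Function.mem_support, ne_eq] at hx ⊢
            contrapose! hx
            simp [hx]))).const_mul M₁
      refine hmaj.mono' ((((hv₁m.inner hbc.stronglyMeasurable).aestronglyMeasurable.mul
        hψc.continuous.aestronglyMeasurable)).mul hρc.aestronglyMeasurable)
        (Eventually.of_forall fun x => ?_)
      rw [norm_mul, norm_mul, Real.norm_of_nonneg (hρpos x).le, Real.norm_eq_abs, Real.norm_eq_abs]
      have h1 : |⟪v₁ x, b x⟫| ≤ M₁ * ‖x‖ :=
        (abs_real_inner_le_norm _ _).trans (mul_le_mul (hv₁b x) (hbn x) (norm_nonneg _)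
          ((norm_nonneg _).trans (hv₁b x)))
      have h2 : 0 ≤ |(ψ : EuclideanSpace ℝ (Fin 2) → ℝ) x| * ρ x := by positivity
      calc |⟪v₁ x, b x⟫| * |(ψ : EuclideanSpace ℝ (Fin 2) → ℝ) x| * ρ x
          = |⟪v₁ x, b x⟫| * (|(ψ : EuclideanSpace ℝ (Fin 2) → ℝ) x| * ρ x) := by ring
        _ ≤ M₁ * ‖x‖ * (|(ψ : EuclideanSpace ℝ (Fin 2) → ℝ) x| * ρ x) :=
            mul_le_mul_of_nonneg_right h1 h2
        _ = M₁ * (‖x‖ * |(ψ : EuclideanSpace ℝ (Fin 2) → ℝ) x| * ρ x) := by ring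
    -- the graph identity
    have key := integral_inner_biotSavart_weight_smul_graph_eq_zero hlam hU₁ ψ
    have hpt : ∀ x, ⟪v₁ x, ρ x • (gradient (ψ : EuclideanSpace ℝ (Fin 2) → ℝ) x -
        (ψ : EuclideanSpace ℝ (Fin 2) → ℝ) x • b x)⟫ =
        ⟪v₁ x, gradient (ψ : EuclideanSpace ℝ (Fin 2) → ℝ) x⟫ * ρ x -
          ⟪v₁ x, b x⟫ * (ψ : EuclideanSpace ℝ (Fin 2) → ℝ) x * ρ x := by
      intro x
      rw [inner_smul_right, inner_sub_right, inner_smul_right]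
      ring
    have key' : ∫ x, (⟪v₁ x, gradient (ψ : EuclideanSpace ℝ (Fin 2) → ℝ) x⟫ * ρ x -
        ⟪v₁ x, b x⟫ * (ψ : EuclideanSpace ℝ (Fin 2) → ℝ) x * ρ x) = 0 := by
      rw [← key]
      exact integral_congr_ae (Eventually.of_forall fun x => (hpt x).symm)
    rw [integral_sub hA hB] at key'
    linarith

end Closure

end Literature.Analysis.FluidPDE
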